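import Mathlib
import Literature.MathematicalPhysics.QuantumFieldTheory.ConstructiveQFTWave0
import Literature.MathematicalPhysics.QuantumFieldTheory.ConstructiveQFTBalabanRG
import Literature.MathematicalPhysics.QuantumLattice.GaugeGroups
import Literature.MathematicalPhysics.QuantumFieldTheory.WilsonFlow
import Literature.MathematicalPhysics.QuantumFieldTheory.Luscher2010.TrivializingMaps
import Literature.MathematicalPhysics.QuantumFieldTheory.Luscher2010.FlowActionSeries
import Summits.Ventures.LatticeQCDFlow.Exactness.IMHKernel
import Summits.Ventures.LatticeQCDFlow.TrivializingMaps.Truncation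
import Summits.Ventures.LatticeQCDFlow.TrivializingMaps.WilsonPolynomials
import HarnessLib

/-!
HONEST FRAMING: exact (Metropolis-corrected) sampling algorithms for lattice gauge theory; figures
of merit are autocorrelation/cost numbers at stated couplings and volumes; no continuum-physics
claim.

# LatticeQCDFlowSanity — review-runbook sanity lemmas for the definitions behind the headline
statements of `Summits/Ventures/LatticeQCDFlow/TrivializingMaps/` (REVIEW-RUNBOOK.md §2, cards D3–D36)

Proposed tree path: `Summits/Ventures/LatticeQCDFlow/Runbook/LatticeQCDFlowSanity.lean` (OURS).

Small closed statements a referee can read in a minute each, of three kinds: (a) AGREEMENT /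
UNFOLDING (two of our definitions of the same object coincide: Lüscher's `boltzmannMeasure` of
`β · S_W` IS Wave 0's `wilsonMeasure`; `trivialMeasure` IS the product Haar measure; the `β = 0`
endpoints), (b) COMPUTED VALUES / INSTANCES (lattice counts; the Wilson action vanishes at the
identity configuration; the independence-Metropolis acceptance `min{1, w(y)/w(x)}` accepts uphill
moves surely and downhill moves with the weight ratio; with a CONSTANT weight — a perfect
trivializing map, model = target — the flow-MCMC kernel is i.i.d. sampling from the model; the
truncated flow action at order `0` / flow time `0`; the zero generator's flow map is the identity;
footprint balls — with `self_mem_plaqLinks`, `self_mem_linkBall`, `linkBall_subset_succ`,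
`truncFlowAction_zero` already in the tree, files `WilsonPolynomials` / `TruncationDefect`),
(c) MEMBERSHIP TESTS (`i σ₃ ∈ 𝔰𝔲(2)`, `1 ∉ 𝔰𝔲(n)`).
Companion file `TrivializingMaps/SuBasisExistence.lean`: `SuBasis n` is inhabited for every `n`
and the hypothesis telescopes of the headline statements are jointly satisfiable.

References: M. Lüscher, Comm. Math. Phys. 293 (2010) 899–919 [key Luscher2010Trivializing];
L. Tierney, Ann. Statist. 22 (1994) 1701–1762, §2.3 (independence Metropolis–Hastings);
J. S. Liu, Statist. Comput. 6 (1996) 113–119; K. G. Wilson, Phys. Rev. D 10 (1974) 2445.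
-/

open MeasureTheory ProbabilityTheory Complex
open Literature.MathematicalPhysics.QuantumFieldTheory
open Literature.MathematicalPhysics.QuantumFieldTheory.Luscher2010
open Summit.Ventures.LatticeQCDFlow.Exactness
open Summit.Ventures.LatticeQCDFlow.TrivializingMaps
open scoped ENNReal

namespace Summit.Ventures.LatticeQCDFlow.Runbook

/-! ## The lattice (cards D3 `Edge`, D4 `Site`, D22 `Plaquette`, D34 `plaquetteHolonomy`, D23 `wilsonAction`) -/

section Lattice

variable {d L : ℕ} [NeZero L]

/-- `|Λ| = L^d` sites on the periodic lattice `(ℤ/Lℤ)^d`. [folklore] -/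
theorem card_site : Fintype.card (Site d L) = L ^ d := by
  simp [Fintype.card_pi, ZMod.card]

/-- `|E| = L^d · d` positively oriented links. [folklore] -/
theorem card_edge : Fintype.card (Edge d L) = L ^ d * d := by
  simp [Fintype.card_prod, Fintype.card_pi, ZMod.card]

/-- In four dimensions there are `6` plaquette orientations `(μ < ν)` per site: `|P| = L^4 · 6`.
[folklore] -/
theorem card_plaquette_four : Fintype.card (Plaquette 4 L) = L ^ 4 * 6 := by
  have h : Fintype.card {p : Fin 4 × Fin 4 // p.1 < p.2} = 6 := by decide
  rw [Fintype.card_prod, h, Fintype.card_pi]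
  simp [ZMod.card]

omit [NeZero L] in
/-- The plaquette holonomy of the identity configuration is the identity. [folklore] -/
theorem plaquetteHolonomy_one {G : Type*} [Group G] (x : Site d L) (i j : Fin d) :
    plaquetteHolonomy (fun _ : Edge d L => (1 : G)) x i j = 1 := by
  simp [plaquetteHolonomy]

/-- **The Wilson action vanishes at the identity configuration** (`Re tr(1 - 1) = 0` on every
plaquette) — its minimum for a unitary representation. [cite: Wilson1974] -/
theorem wilsonAction_one {G : Type*} [Group G] {N : ℕ} (ρ : G →* Matrix (Fin N) (Fin N) ℂ) :
    wilsonAction (d := d) (L := L) ρ (fun _ => 1) = 0 := by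
  simp [wilsonAction, plaquetteHolonomy, Matrix.trace_one]

end Lattice

/-! ## The measures (cards D29 `haarProbability`, D14 `trivialMeasure`, D30 `partitionFn`,
D15 `boltzmannMeasure`, D33 `wilsonWeight`, D21 `partitionFunction`) -/

section Measures

variable {G : Type*} [Group G] [TopologicalSpace G] [IsTopologicalGroup G] [CompactSpace G]
  [MeasurableSpace G] [BorelSpace G] {d L N : ℕ} [NeZero L]

/-- The normalised Haar measure has total mass one (instance
`haarProbability.instIsProbabilityMeasure` of `QuantumLattice.GaugeGroups`, restated as a value).
[folklore] -/
theorem haarProbability_univ : haarProbability G Set.univ = 1 := measure_univ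

/-- AGREEMENT: Lüscher's "trivial theory" `D[V]` (card D14) IS the product of the normalised Haar
measures of the links used by Wave 0's `wilsonWeight` (card D33) — definitionally.
[cite: Luscher2010Trivializing, §2.1 eq. (2.1)] -/
theorem trivialMeasure_eq_pi (d L : ℕ) [NeZero L] :
    trivialMeasure G d L = Measure.pi fun _ : Edge d L => haarProbability G := rfl

/-- `D[V]` is a probability measure for every compact group `G`. [cite: Luscher2010Trivializing, §2.1 eq. (2.1)] -/
theorem isProbabilityMeasure_trivialMeasure (d L : ℕ) [NeZero L] :
    IsProbabilityMeasure (trivialMeasure G d L) := by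
  rw [trivialMeasure_eq_pi]; infer_instance

/-- COMPUTED VALUE: the partition function of the ZERO action is `1` (card D30).
[cite: Luscher2010Trivializing, §2.1 eq. (2.1)] -/
theorem partitionFn_zero : partitionFn (fun _ : GaugeConfig d L G => (0 : ℝ)) = 1 := by
  haveI := isProbabilityMeasure_trivialMeasure (G := G) d L
  simp [partitionFn]

/-- COMPUTED VALUE / `β = 0` ENDPOINT: the Boltzmann measure of the ZERO action is the trivial theory
`D[V]` itself (card D15) — at `β = 0` the identity map is trivializing.
[cite: Luscher2010Trivializing, §2.1 eq. (2.1)] -/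
theorem boltzmannMeasure_zero :
    boltzmannMeasure (fun _ : GaugeConfig d L G => (0 : ℝ)) = trivialMeasure G d L := by
  rw [boltzmannMeasure, partitionFn_zero]
  simp only [neg_zero, Real.exp_zero, ENNReal.ofReal_one, inv_one, one_smul]
  exact withDensity_one

/-- `β = 0` ENDPOINT of Wave 0's Wilson weight (card D33): `e^{-0·S} ∏ dU_e = ∏ dU_e = D[U]`.
[cite: Wilson1974] -/
theorem wilsonWeight_zero (ρ : G →* Matrix (Fin N) (Fin N) ℂ) :
    wilsonWeight (d := d) (L := L) ρ 0 = trivialMeasure G d L := by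
  rw [wilsonWeight, trivialMeasure_eq_pi]
  simp only [neg_zero, zero_mul, Real.exp_zero, ENNReal.ofReal_one]
  exact withDensity_one

/-- COMPUTED VALUE: Wave 0's partition function at `β = 0` is `1` (card D21). [cite: Wilson1974] -/
theorem partitionFunction_zero (ρ : G →* Matrix (Fin N) (Fin N) ℂ) :
    partitionFunction (d := d) (L := L) ρ 0 = 1 := by
  haveI := isProbabilityMeasure_trivialMeasure (G := G) d L
  rw [partitionFunction, wilsonWeight_zero, measure_univ]

/-- AGREEMENT (the claim in the docstring of `boltzmannMeasure`, now a theorem): Lüscher's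
Boltzmann measure of the action `β · S_W` (cards D15, D30) IS Wave 0's Wilson lattice gauge measure
`wilsonMeasure ρ β = Z⁻¹ e^{-β S_W} ∏ dU_e` (cards D21, D23, D33) — same normalisation, same density.
[cite: Luscher2010Trivializing, §2.1 eq. (2.1)] -/
theorem boltzmannMeasure_wilson_eq (ρ : G →* Matrix (Fin N) (Fin N) ℂ) (β : ℝ) :
    boltzmannMeasure (fun U : GaugeConfig d L G => β * wilsonAction ρ U) = wilsonMeasure ρ β := by
  simp only [boltzmannMeasure, wilsonMeasure, partitionFn, partitionFunction, wilsonWeight,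
    trivialMeasure_eq_pi, neg_mul, withDensity_apply _ MeasurableSet.univ, Measure.restrict_univ]

end Measures

/-! ## The flow-MCMC kernel (cards D35 `imhAccept`, D31 `imhAcceptE`, D18 `imhAcceptMass`, D17 `indepMH`) -/

section Sampler

variable {Ω : Type*} [MeasurableSpace Ω]

omit [MeasurableSpace Ω] in
/-- Independence Metropolis: an UPHILL proposal (`w(y) ≥ w(x)`, i.e. target/model ratio not
smaller) is accepted surely. [folklore; Tierney 1994 §2.3, Liu 1996] -/
theorem imhAccept_of_le {w : Ω → ℝ} {x y : Ω} (hx : 0 < w x) (h : w x ≤ w y) :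
    imhAccept w x y = 1 :=
  min_eq_left ((one_le_div hx).mpr h)

omit [MeasurableSpace Ω] in
/-- Independence Metropolis: a DOWNHILL proposal (`w(y) ≤ w(x)`) is accepted with probability the
weight ratio `w(y)/w(x)`. [folklore; Tierney 1994 §2.3, Liu 1996] -/
theorem imhAccept_of_ge {w : Ω → ℝ} {x y : Ω} (hx : 0 < w x) (h : w y ≤ w x) :
    imhAccept w x y = w y / w x :=
  min_eq_right ((div_le_one hx).mpr h)

omit [MeasurableSpace Ω] in
/-- A move to a state of the same weight is accepted surely; in particular for a CONSTANT weight
(model = target: a perfect trivializing map) every proposal is accepted. [folklore] -/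
theorem imhAccept_const {c : ℝ} (hc : c ≠ 0) (x y : Ω) : imhAccept (fun _ : Ω => c) x y = 1 := by
  simp [imhAccept, div_self hc]

omit [MeasurableSpace Ω] in
/-- The `ℝ≥0∞` acceptance density of a constant weight is `1` (card D31). [folklore] -/
theorem imhAcceptE_const {c : ℝ} (hc : c ≠ 0) (x y : Ω) : imhAcceptE (fun _ : Ω => c) x y = 1 := by
  simp [imhAcceptE, imhAccept_const hc]

/-- The total acceptance mass of a constant weight is `1` from every state (card D18). [folklore] -/
theorem imhAcceptMass_const (q : Measure Ω) [IsProbabilityMeasure q] {c : ℝ} (hc : c ≠ 0) (x : Ω) :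
    imhAcceptMass q (fun _ : Ω => c) x = 1 := by
  simp [imhAcceptMass, imhAcceptE_const hc]

/-- **A perfect model makes flow-MCMC i.i.d. sampling** (card D17): for a CONSTANT weight
`w = dπ/dq` (the flow pushes the trivial theory exactly onto the target) the independence
Metropolis–Hastings kernel is the constant kernel `K(x, ·) = q` — every proposal accepted, no
autocorrelation. The ideal endpoint of Lüscher's programme, as a closed identity of our kernel.
[folklore; Tierney 1994 §2.3] -/
theorem indepMH_const (q : Measure Ω) [IsProbabilityMeasure q] {c : ℝ} (hc : c ≠ 0) :
    indepMH q (fun _ : Ω => c) = Kernel.const Ω q := by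
  ext x B hB
  rw [indepMH_apply measurable_const x hB, Kernel.const_apply, imhAcceptMass_const q hc]
  simp [imhAcceptE_const hc]

end Sampler

/-! ## Lüscher's calculus (cards D20 `linkDeriv`, D11 `linkGrad`, D25 `linkLap`, D12 `truncFlowAction`,
D28 `IsFlowLine`, D10 `IsFlowMap`, D27 `Generator`, D16 `coeConfig`) -/

section Calculus

variable {d L n : ℕ}

/-- The link derivative `∂^X_e` kills constants. [cite: Luscher2010Trivializing, App. A.2 eq. (A.5)] -/
theorem linkDeriv_const (e : Edge d L) (X : Matrix (Fin n) (Fin n) ℂ) (c : ℝ) (W : AmbConfig d L n) :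
    linkDeriv e X (fun _ => c) W = 0 := by
  simp [linkDeriv]

/-- The link gradient of a constant vanishes. [cite: Luscher2010Trivializing, App. A.2 eq. (A.5)] -/
theorem linkGrad_const (B : SuBasis n) (c : ℝ) (W : AmbConfig d L n) :
    linkGrad B (fun _ => c) W = 0 := by
  funext e
  simp [linkGrad, linkDeriv_const]

/-- The link Laplacian of a constant vanishes. [cite: Luscher2010Trivializing, App. A.2 eq. (A.6)] -/
theorem linkLap_const [NeZero L] (B : SuBasis n) (c : ℝ) (W : AmbConfig d L n) :
    linkLap B (fun _ => c) W = 0 := by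
  have h : ∀ (e : Edge d L) (a : B.ι), linkDeriv e (B.T a) (fun _ : AmbConfig d L n => c) = fun _ => 0 :=
    fun e a => funext fun W => linkDeriv_const e (B.T a) c W
  simp [linkLap, h, linkDeriv_const]

/-- COMPUTED VALUE: at flow time `0` every truncation reduces to the leading coefficient,
`S̃^{[N]}_0 = S^{(0)}`. [cite: Luscher2010Trivializing, §3.3 eq. (3.9)] -/
theorem truncFlowAction_time_zero (Sk : ℕ → AmbConfig d L n → ℝ) (N : ℕ) :
    truncFlowAction Sk 0 N = Sk 0 := by
  funext W
  rw [truncFlowAction, Finset.sum_eq_single 0]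
  · simp
  · intro k _ hk
    simp [zero_pow hk]
  · simp

/-- UNFOLDING: `coeConfig` is the entrywise inclusion `SU(n)^E ↪ M_n(ℂ)^E` (card D16). [folklore] -/
theorem coeConfig_apply (U : GaugeConfig d L (Matrix.specialUnitaryGroup (Fin n) ℂ)) (e : Edge d L) :
    WilsonFlow.coeConfig U e = ((U e : Matrix.specialUnitaryGroup (Fin n) ℂ) : Matrix (Fin n) (Fin n) ℂ) :=
  rfl

/-- INHABITED: a constant curve is a flow line of the ZERO generator (cards D27, D28).
[cite: Luscher2010Trivializing, §3.1 eq. (3.2)] -/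
theorem isFlowLine_zero_const (W : AmbConfig d L n) :
    IsFlowLine (fun (_ : ℝ) (_ : AmbConfig d L n) => (0 : AmbConfig d L n)) fun _ => W := by
  intro t e i j
  simpa using hasDerivAt_const t (W e i j)

/-- INHABITED: the flow map of the ZERO generator is the identity for all times (card D10) — the
`t`-independent family `Φ_t = id` satisfies `Φ_0 = id` and the flow equation `U̇ = 0 · U`.
[cite: Luscher2010Trivializing, §3.2] -/
theorem isFlowMap_zero_id :
    IsFlowMap (d := d) (L := L) (n := n) (fun (_ : ℝ) (_ : AmbConfig d L n) => (0 : AmbConfig d L n))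
      fun _ V => V :=
  ⟨fun _ => rfl, fun V => isFlowLine_zero_const (WilsonFlow.coeConfig V)⟩

end Calculus

/-! ## Footprints (cards D36 `plaqLinks`, D32 `plaqNbhd`, D19 `linkBall`) and `𝔰𝔲(n)` (card D24) -/

section Footprint

variable {d L : ℕ}

/-- A link lies in its own plaquette-neighbourhood as soon as `d ≥ 2` (some `ν ≠ μ` exists).
[folklore] -/
theorem mem_plaqNbhd_self (x : Site d L) {μ ν : Fin d} (h : μ ≠ ν) : (x, μ) ∈ plaqNbhd (x, μ) :=
  ⟨x, μ, ν, h, self_mem_plaqLinks x μ ν, self_mem_plaqLinks x μ ν⟩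

/-- The radius-`0` footprint ball of a link is the link itself. [folklore] -/
theorem mem_linkBall_zero {e e' : Edge d L} : e' ∈ linkBall 0 e ↔ e' = e := Set.mem_singleton_iff

end Footprint

section SuAlgebra

/-- MEMBERSHIP TEST (holds): `i σ₃ = diag(i, -i) ∈ 𝔰𝔲(2)` — skew-Hermitian and traceless.
[folklore] -/
theorem diag_I_negI_mem_suAlgebra_two : !![I, 0; 0, -I] ∈ suAlgebra 2 := by
  rw [mem_suAlgebra_iff]
  constructor
  · ext i j
    fin_cases i <;> fin_cases j <;> simp [Matrix.conjTranspose_apply]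
  · simp [Matrix.trace_fin_two]

/-- MEMBERSHIP TEST (fails): the identity matrix is NOT in `𝔰𝔲(n)` for `n ≥ 1` (trace `n ≠ 0`) —
the predicate is not trivially true. [folklore] -/
theorem one_not_mem_suAlgebra {n : ℕ} (hn : n ≠ 0) : (1 : Matrix (Fin n) (Fin n) ℂ) ∉ suAlgebra n := by
  rw [mem_suAlgebra_iff, Matrix.trace_one, Fintype.card_fin]
  exact fun h => hn (by exact_mod_cast h.2)

/-- The zero matrix is in `𝔰𝔲(n)` (it is a real subspace). [folklore] -/
theorem zero_mem_suAlgebra (n : ℕ) : (0 : Matrix (Fin n) (Fin n) ℂ) ∈ suAlgebra n :=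
  Submodule.zero_mem _

end SuAlgebra

end Summit.Ventures.LatticeQCDFlow.Runbook
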